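import Literature.IUT.HodgeTheaters.Ex54ivInfKappaArithRatGalois
import Literature.IUT.HodgeTheaters.KappaCoricPseudoMonoidsProofs
import Literature.IUT.HodgeTheaters.KappaCoricFunctionsExistence
import HarnessLib

/-!
# [IUTchI] Rmk 3.1.7 (ii) p. 68 / Ex 5.1 (v) p. 127 at the genuine rational Galois layer: the pairs
# `G_L^{rat} ↷ 𝕄_{∞κ}(Λ_L)`, `𝕄_{∞κ×}(Λ_L)` are DIVISIBLE and CYCLOTOMIC pseudo-monoids (proof-only companion of
# `Ex54ivInfKappaArithRatGalois.lean`, abc-iut gap B = G-L5t9g8-1, item GB-01 / row D1)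

S. Mochizuki, *Inter-universal Teichmüller theory I*, kurims manuscript (May 2020), §3 Remark 3.1.7 (ii) p. 68
l. 1–4: "one verifies immediately that the operation of multiplication determines a structure of pseudo-monoid
[cf. §0] on the sets of `κ`-, `∞κ`-, and `∞κ×`-coric rational functions; moreover, in the case of `∞κ`- and
`∞κ×`-coric rational functions, the resulting pseudo-monoid is *divisible* and *cyclotomic*"; §0 p. 33 (divisible /
cyclotomic pseudo-monoids); §5 Example 5.1 (v) p. 127 ("a pair consisting of a pseudo-monoid equipped with a
continuous action by `π₁^{rat}(†𝒟^⊛)`"; the Kummer theory of `†𝕄^⊛_∞κ` uses `μ_Ẑ(†𝕄^⊛_∞κ)`, i.e. cyclotomicity) and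
Remark 5.1.3 p. 132 (`†𝕄^⊛_∞κ`, `†𝕄^⊛_∞κ×` are *Kummer-ready*) ([IUTchI] Rmk 3.1.7 (ii) p.68, Ex 5.1 (v) p.127)
[claim: Mochizuki2012, status: disputed] (D-0012 claim key — elementary field theory at the MODEL; nothing disputed
is involved; no side is taken on [IUTchIII] Cor. 3.12).

## What is proved (PROOF-ONLY: no definition, no instance, no notation, no new `Prop` fact)

abc-iut's `KappaCoricPseudoMonoidsProofs.lean` proves divisibility / cyclotomicity for the pseudo-monoid
`PartialMul.ofSubset {x : Λˣ | IsInftyKappaCoricIn …}` (carrier inside `Λˣ`).  The GENUINE PAIRS of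
`Ex54ivInfKappaArithRatGalois.lean` (★ p666587) carry their elements inside `Λ` (shape of
`NFBridgeRecon.coricPairOfSubset`, as the consumer `InfKappaLink` expects), so the two adjectives are re-derived for
THAT partial multiplication, realised in `Λˣ` by `x ↦ x`:
* `CoricPair.isRealizedBy_units_ofStableSet`, `range_units_ofStableSet` — the realisation and its image;
* `CoricPair.isDivisible_ofStableSet`, `CoricPair.isCyclotomic_ofStableSet` — §0 criteria for
  `CoricPair.ofStableSet K Λ M hM` (`Λ` algebraically closed [of characteristic `0`], `0 ∉ M`, `M` closed under
  `n`-th powers/roots, resp. containing and stable under the roots of unity; `μ(Λ) ≅ ℚ/ℤ` is abc-iut's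
  `nonempty_torsion_mulEquiv_qModZ`);
* `CriticalLocus.isDivisible_infKappaCoricPairIn`, `isCyclotomic_infKappaCoricPairIn`, `…UnitCoricPairIn` (unit
  parameter closed under powers and roots, resp. `∋ 1`) — **Rmk 3.1.7 (ii) p. 68 at the pairs over any algebraic,
  algebraically closed `Λ ⊇ Ω(t)`**, from abc-iut's `isInftyKappaCoricIn_pow_iff`, `…_of_pow_eq_one`,
  `…_mul_of_pow_eq_one`, `isInftyKappaUnitCoricIn_pow_iff`;
* row D1 at `Λ_L`: `isDivisible_infKappaCoricPair`, `isCyclotomic_infKappaCoricPair`, the unit versions and the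
  instance `U_L = L ∖ {0}` for `L` algebraically closed (`isDivisible_isCyclotomic_infKappaUnitCoricPair_ne_zero`);
* non-vacuity: `algebraMap_mem_infKappaCoricSetIn_iff` (the pair contains exactly the `κ`-coric rational functions
  among rational functions), `nonempty_…_carrier` (`1`), and `exists_infKappaCoricPair_ne_C` — for `L` algebraically
  closed and strictly critical points algebraic over `ℚ` the carrier has a NON-CONSTANT element (abc-iut's
  `existsKappaCoricDegreeFour_holds`, Rmk 3.1.7 (ii) "there exists a `κ`-coric `f_sol ∈ L_C` of degree `4`").

Honest scope: model presentation (C1 of GAP-SIZING-B.md, RULINGS #316 (i): count-neutral); typed ≠ proved ≠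
tokened; nothing here asserts that abc is proved or refuted.
-/

namespace Literature.IUT.HodgeTheaters

universe u v

/-! ### Criteria: the pair `CoricPair.ofStableSet K Λ M hM` is a divisible / cyclotomic pseudo-monoid -/

namespace CoricPair

variable {K : Type u} {Λ : Type v} [Field K] [Field Λ] [Algebra K Λ] [Algebra.IsIntegral K Λ] {M : Set Λ}
  {hM : ∀ (σ : Λ ≃ₐ[K] Λ) {x : Λ}, x ∈ M → σ • x ∈ M}

/-- Elements of a subset `M ∌ 0` of a field are nonzero (pointwise form used to build the realisation in `Λˣ`).
([IUTchI] Ex 5.1 (v) p.127) [claim: Mochizuki2012, status: disputed] -/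
theorem coe_ne_zero_of_zero_notMem (h0 : (0 : Λ) ∉ M) (x : (ofStableSet K Λ M hM).carrier) : (x : Λ) ≠ 0 :=
  fun hx => h0 (hx ▸ x.2)

/-- The pair `ofStableSet K Λ M hM` (`0 ∉ M`) is REALISED ([IUTchI] §0 p. 33) in the multiplicative group `Λˣ` by
`x ↦ x` (as a unit). ([IUTchI] Ex 5.1 (v) p.127) [claim: Mochizuki2012, status: disputed] -/
theorem isRealizedBy_units_ofStableSet (h0 : (0 : Λ) ∉ M) :
    (ofStableSet K Λ M hM).pm.IsRealizedBy Λˣ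
      (fun x => Units.mk0 (x : Λ) (coe_ne_zero_of_zero_notMem h0 x)) := by
  classical
  refine ⟨?_, ?_, ?_⟩
  · intro x y hxy
    apply Subtype.ext
    simpa [Units.mk0] using congrArg (fun u : Λˣ => (u : Λ)) hxy
  · ext p
    change (p.1 : Λ) * p.2 ∈ M ↔ _
    constructor
    · intro hp
      refine ⟨⟨(p.1 : Λ) * p.2, hp⟩, Units.ext ?_⟩
      simp
    · rintro ⟨z, hz⟩
      have hz' := congrArg (fun u : Λˣ => (u : Λ)) hz
      simp only [Units.val_mk0, Units.val_mul] at hz'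
      rw [← hz']
      exact z.2
  · intro p
    exact Units.ext (by simp)

/-- The image of that realisation is `{u ∈ Λˣ | u ∈ M}`. ([IUTchI] Ex 5.1 (v) p.127) [claim: Mochizuki2012, status: disputed] -/
theorem range_units_ofStableSet (h0 : (0 : Λ) ∉ M) :
    Set.range (fun x : (ofStableSet K Λ M hM).carrier => Units.mk0 (x : Λ) (coe_ne_zero_of_zero_notMem h0 x)) =
      {u : Λˣ | (u : Λ) ∈ M} := by
  ext u
  constructor
  · rintro ⟨x, rfl⟩
    exact x.2
  · intro hu
    exact ⟨⟨(u : Λ), hu⟩, Units.ext (by simp)⟩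

/-- **Divisibility criterion** ([IUTchI] §0 p. 33: "for each positive integer `n`, every element of `M` admits an
`n`-th root in `M`, and … `a ∈ ι(P)` iff `aⁿ ∈ ι(P)`"): for `Λ` algebraically closed and `M ∌ 0` closed under `n`-th
powers and `n`-th roots, the pair `ofStableSet K Λ M hM` is a DIVISIBLE pseudo-monoid (realised in `Λˣ`).
([IUTchI] Rmk 3.1.7 (ii) p.68) [claim: Mochizuki2012, status: disputed] -/
theorem isDivisible_ofStableSet [IsAlgClosed Λ] (h0 : (0 : Λ) ∉ M)
    (hpow : ∀ n : ℕ, 0 < n → ∀ x : Λ, x ∈ M ↔ x ^ n ∈ M) : (ofStableSet K Λ M hM).pm.IsDivisible := by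
  refine ⟨Λˣ, inferInstance, _, isRealizedBy_units_ofStableSet h0, fun n hn => ⟨fun a => ?_, fun a => ?_⟩⟩
  · obtain ⟨z, hz⟩ := IsAlgClosed.exists_pow_nat_eq (a : Λ) hn
    have hz0 : z ≠ 0 := fun hz0 => a.ne_zero (by rw [← hz, hz0, zero_pow hn.ne'])
    exact ⟨Units.mk0 z hz0, Units.ext (by rw [Units.val_pow_eq_pow_val, Units.val_mk0, hz])⟩
  · rw [range_units_ofStableSet h0]
    change (a : Λ) ∈ M ↔ ((a ^ n : Λˣ) : Λ) ∈ M
    rw [Units.val_pow_eq_pow_val]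
    exact hpow n hn a

/-- **Cyclotomicity criterion** ([IUTchI] §0 p. 33: "`μ_M ≅ ℚ/ℤ`, `μ_M ⊆ ι(P)`, `μ_M·ι(P) ⊆ ι(P)`"): for `Λ` algebraically
closed of characteristic `0` and `M ∌ 0` containing the roots of unity and stable under multiplication by them, the
pair `ofStableSet K Λ M hM` is a CYCLOTOMIC pseudo-monoid (`μ(Λ) ≅ ℚ/ℤ` is abc-iut's `nonempty_torsion_mulEquiv_qModZ`).
([IUTchI] Rmk 3.1.7 (ii) p.68) [claim: Mochizuki2012, status: disputed] -/
theorem isCyclotomic_ofStableSet [IsAlgClosed Λ] [CharZero Λ] (h0 : (0 : Λ) ∉ M)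
    (hroot : ∀ (ζ : Λ) (n : ℕ), 0 < n → ζ ^ n = 1 → ζ ∈ M)
    (hmul : ∀ (ζ x : Λ) (n : ℕ), 0 < n → ζ ^ n = 1 → x ∈ M → ζ * x ∈ M) :
    (ofStableSet K Λ M hM).pm.IsCyclotomic := by
  refine ⟨Λˣ, inferInstance, _, isRealizedBy_units_ofStableSet h0, nonempty_torsion_mulEquiv_qModZ Λ, ?_, ?_⟩
  · intro t ht
    rw [SetLike.mem_coe, CommGroup.mem_torsion, isOfFinOrder_iff_pow_eq_one] at ht
    obtain ⟨n, hn, htn⟩ := ht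
    rw [range_units_ofStableSet h0]
    exact hroot (t : Λ) n hn (by rw [← Units.val_pow_eq_pow_val, htn, Units.val_one])
  · intro t ht a ha
    rw [CommGroup.mem_torsion, isOfFinOrder_iff_pow_eq_one] at ht
    obtain ⟨n, hn, htn⟩ := ht
    rw [range_units_ofStableSet h0] at ha ⊢
    change ((t * a : Λˣ) : Λ) ∈ M
    rw [Units.val_mul]
    exact hmul (t : Λ) (a : Λ) n hn (by rw [← Units.val_pow_eq_pow_val, htn, Units.val_one]) ha

end CoricPair

/-! ### Rmk 3.1.7 (ii) p. 68 at the genuine pairs: `𝕄_{∞κ}`, `𝕄_{∞κ×}` are divisible and cyclotomic -/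

namespace CriticalLocus

variable {Ω : Type u} [Field Ω] [CharZero Ω] (S : CriticalLocus Ω) (Λ : Type v) [Field Λ]
  [Algebra (RatFunc Ω) Λ] [Algebra.IsIntegral (RatFunc Ω) Λ]

/-- **The `∞κ`-pair `Gal(Λ/Ω(t)) ↷ 𝕄_{∞κ}(Λ)` is a DIVISIBLE pseudo-monoid** for `Λ` algebraically closed ("in the case
of `∞κ`- and `∞κ×`-coric rational functions, the resulting pseudo-monoid is divisible and cyclotomic"; `a` is
`∞κ`-coric iff `aⁿ` is — abc-iut's `isInftyKappaCoricIn_pow_iff`). ([IUTchI] Rmk 3.1.7 (ii) p.68)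
[claim: Mochizuki2012, status: disputed] -/
theorem isDivisible_infKappaCoricPairIn [IsAlgClosed Λ] : (S.infKappaCoricPairIn Λ).pm.IsDivisible :=
  CoricPair.isDivisible_ofStableSet S.zero_notMem_infKappaCoricSetIn
    fun _ hn x => (S.isInftyKappaCoricIn_pow_iff Λ hn x).symm

/-- **The `∞κ`-pair is a CYCLOTOMIC pseudo-monoid** for `Λ` algebraically closed (roots of unity are `∞κ`-coric and
act on `∞κ`-coric elements — abc-iut's `isInftyKappaCoricIn_of_pow_eq_one`, `isInftyKappaCoricIn_mul_of_pow_eq_one`).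
([IUTchI] Rmk 3.1.7 (ii) p.68) [claim: Mochizuki2012, status: disputed] -/
theorem isCyclotomic_infKappaCoricPairIn [IsAlgClosed Λ] : (S.infKappaCoricPairIn Λ).pm.IsCyclotomic :=
  haveI : CharZero Λ := (RingHom.charZero_iff (algebraMap (RatFunc Ω) Λ).injective).1 inferInstance
  CoricPair.isCyclotomic_ofStableSet S.zero_notMem_infKappaCoricSetIn
    (fun _ _ hn h => S.isInftyKappaCoricIn_of_pow_eq_one Λ hn h)
    (fun _ _ _ hn h hx => S.isInftyKappaCoricIn_mul_of_pow_eq_one Λ hn h hx)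

/-- **The `∞κ×`-pair `Gal(Λ/Ω(t)) ↷ 𝕄_{∞κ×}(Λ)` is a DIVISIBLE pseudo-monoid** for `Λ` algebraically closed and a unit
parameter `U` closed under powers and roots (as `U_L = L̄^×`, resp. the units of `L̄`, is).
([IUTchI] Rmk 3.1.7 (ii) p.68) [claim: Mochizuki2012, status: disputed] -/
theorem isDivisible_infKappaUnitCoricPairIn [IsAlgClosed Λ] {U : Set Ω} (hUpow : ∀ c ∈ U, ∀ n : ℕ, c ^ n ∈ U)
    (hUroot : ∀ c ∈ U, ∀ n : ℕ, 0 < n → ∃ d ∈ U, d ^ n = c) :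
    (S.infKappaUnitCoricPairIn Λ U).pm.IsDivisible :=
  CoricPair.isDivisible_ofStableSet (S.zero_notMem_infKappaUnitCoricSetIn U)
    fun _ hn x => (S.isInftyKappaUnitCoricIn_pow_iff Λ hUpow hUroot hn x).symm

/-- **The `∞κ×`-pair is a CYCLOTOMIC pseudo-monoid** for `Λ` algebraically closed and `1 ∈ U`.
([IUTchI] Rmk 3.1.7 (ii) p.68) [claim: Mochizuki2012, status: disputed] -/
theorem isCyclotomic_infKappaUnitCoricPairIn [IsAlgClosed Λ] {U : Set Ω} (hU1 : (1 : Ω) ∈ U) :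
    (S.infKappaUnitCoricPairIn Λ U).pm.IsCyclotomic := by
  haveI : CharZero Λ := (RingHom.charZero_iff (algebraMap (RatFunc Ω) Λ).injective).1 inferInstance
  refine CoricPair.isCyclotomic_ofStableSet (S.zero_notMem_infKappaUnitCoricSetIn U)
    (fun ζ n hn h => S.infKappaCoricSetIn_subset_infKappaUnitCoricSetIn hU1
      (S.isInftyKappaCoricIn_of_pow_eq_one Λ hn h)) (fun ζ x n hn h hx => ?_)
  obtain ⟨c, hc, hcx⟩ := hx
  refine ⟨c, hc, ?_⟩
  rw [mul_left_comm]
  exact S.isInftyKappaCoricIn_mul_of_pow_eq_one Λ hn h hcx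

/-- The carrier of the `∞κ`-pair is nonempty (`1` is `∞κ`-coric). ([IUTchI] Ex 5.1 (v) p.127)
[claim: Mochizuki2012, status: disputed] -/
theorem nonempty_infKappaCoricPairIn_carrier : Nonempty (S.infKappaCoricPairIn Λ).carrier :=
  ⟨⟨1, S.one_mem_infKappaCoricSetIn⟩⟩

omit [Algebra.IsIntegral (RatFunc Ω) Λ] in
/-- A rational function lies in `𝕄_{∞κ}(Λ)` iff it is `κ`-coric ("an element `f ∈ L_C` is `κ`-coric if and only if it
is `∞κ`-coric" — abc-iut's `isInftyKappaCoricIn_algebraMap_iff_isKappaCoric`): the pair CONTAINS print's `𝕄_κ`.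
([IUTchI] Rmk 3.1.7 (ii) p.67) [claim: Mochizuki2012, status: disputed] -/
theorem algebraMap_mem_infKappaCoricSetIn_iff (h : RatFunc Ω) :
    algebraMap (RatFunc Ω) Λ h ∈ S.infKappaCoricSetIn Λ ↔ S.IsKappaCoric h :=
  S.isInftyKappaCoricIn_algebraMap_iff_isKappaCoric Λ h

omit [Algebra.IsIntegral (RatFunc Ω) Λ] in
/-- NON-VACUITY beyond the roots of unity: for `Ω` algebraically closed and strictly critical points algebraic
over `ℚ` (as in print: images of `2`-torsion points of `E_F`), `𝕄_{∞κ}(Λ)` contains a NON-CONSTANT element — the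
`κ`-coric function of degree `4` of Rmk 3.1.7 (ii) (abc-iut's `existsKappaCoricDegreeFour_holds`).
([IUTchI] Rmk 3.1.7 (ii) p.67) [claim: Mochizuki2012, status: disputed] -/
theorem exists_mem_infKappaCoricSetIn_ne_C [IsAlgClosed Ω] (hS : ∀ e ∈ S.pts, IsAlgebraic ℚ e) :
    ∃ x ∈ S.infKappaCoricSetIn Λ, ∀ c : Ω, x ≠ algebraMap (RatFunc Ω) Λ (RatFunc.C c) := by
  obtain ⟨f, hf, hdeg⟩ := S.existsKappaCoricDegreeFour_holds hS
  refine ⟨algebraMap (RatFunc Ω) Λ f, (S.algebraMap_mem_infKappaCoricSetIn_iff Λ f).2 hf, fun c hc => ?_⟩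
  have hfc : f = RatFunc.C c := (algebraMap (RatFunc Ω) Λ).injective hc
  rw [hfc, RatFunc.num_C, Polynomial.natDegree_C] at hdeg
  exact absurd hdeg (by norm_num)

/-! ### Row D1 at `Λ_L`: `G_L^{rat} ↷ 𝕄_{∞κ}(Λ_L)`, `𝕄_{∞κ×}(Λ_L)` are Kummer-ready (divisible, cyclotomic) -/

variable {L : Type u} [Field L] [CharZero L] (T : CriticalLocus L)

/-- `G_L^{rat} ↷ 𝕄_{∞κ}(Λ_L)` is a divisible pseudo-monoid. ([IUTchI] Rmk 3.1.7 (ii) p.68) [claim: Mochizuki2012, status: disputed] -/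
theorem isDivisible_infKappaCoricPair : T.infKappaCoricPair.pm.IsDivisible :=
  T.isDivisible_infKappaCoricPairIn (RatAlgClosure L)

/-- `G_L^{rat} ↷ 𝕄_{∞κ}(Λ_L)` is a cyclotomic pseudo-monoid. ([IUTchI] Rmk 3.1.7 (ii) p.68) [claim: Mochizuki2012, status: disputed] -/
theorem isCyclotomic_infKappaCoricPair : T.infKappaCoricPair.pm.IsCyclotomic :=
  T.isCyclotomic_infKappaCoricPairIn (RatAlgClosure L)

/-- `G_L^{rat} ↷ 𝕄_{∞κ×}(Λ_L)` is a divisible pseudo-monoid, for `U` closed under powers and roots.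
([IUTchI] Rmk 3.1.7 (ii) p.68) [claim: Mochizuki2012, status: disputed] -/
theorem isDivisible_infKappaUnitCoricPair {U : Set L} (hUpow : ∀ c ∈ U, ∀ n : ℕ, c ^ n ∈ U)
    (hUroot : ∀ c ∈ U, ∀ n : ℕ, 0 < n → ∃ d ∈ U, d ^ n = c) : (T.infKappaUnitCoricPair U).pm.IsDivisible :=
  T.isDivisible_infKappaUnitCoricPairIn (RatAlgClosure L) hUpow hUroot

/-- `G_L^{rat} ↷ 𝕄_{∞κ×}(Λ_L)` is a cyclotomic pseudo-monoid, for `1 ∈ U`. ([IUTchI] Rmk 3.1.7 (ii) p.68)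
[claim: Mochizuki2012, status: disputed] -/
theorem isCyclotomic_infKappaUnitCoricPair {U : Set L} (hU1 : (1 : L) ∈ U) :
    (T.infKappaUnitCoricPair U).pm.IsCyclotomic :=
  T.isCyclotomic_infKappaUnitCoricPairIn (RatAlgClosure L) hU1

/-- The instance `U_L = L ∖ {0}` for `L` algebraically closed (`L = F̄`, `\overline{K_v}`): `G_L^{rat} ↷ 𝕄_{∞κ×}(Λ_L)` is
divisible and cyclotomic. ([IUTchI] Rmk 3.1.7 (ii) p.68) [claim: Mochizuki2012, status: disputed] -/
theorem isDivisible_isCyclotomic_infKappaUnitCoricPair_ne_zero [IsAlgClosed L] :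
    (T.infKappaUnitCoricPair {c : L | c ≠ 0}).pm.IsDivisible ∧
      (T.infKappaUnitCoricPair {c : L | c ≠ 0}).pm.IsCyclotomic := by
  refine ⟨T.isDivisible_infKappaUnitCoricPair (fun c hc n => pow_ne_zero n hc) (fun c hc n hn => ?_),
    T.isCyclotomic_infKappaUnitCoricPair one_ne_zero⟩
  obtain ⟨d, hd⟩ := IsAlgClosed.exists_pow_nat_eq c hn
  exact ⟨d, fun hd0 => hc (by rw [← hd, hd0, zero_pow hn.ne']), hd⟩

/-- The carrier of `G_L^{rat} ↷ 𝕄_{∞κ}(Λ_L)` is nonempty. ([IUTchI] Ex 5.1 (v) p.127) [claim: Mochizuki2012, status: disputed] -/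
theorem nonempty_infKappaCoricPair_carrier : Nonempty T.infKappaCoricPair.carrier :=
  T.nonempty_infKappaCoricPairIn_carrier (RatAlgClosure L)

/-- NON-VACUITY of row D1 beyond constants: for `L` algebraically closed (`F̄`, `\overline{K_v}`) and strictly critical
points algebraic over `ℚ`, the carrier of `G_L^{rat} ↷ 𝕄_{∞κ}(Λ_L)` has a non-constant element.
([IUTchI] Rmk 3.1.7 (ii) p.67) [claim: Mochizuki2012, status: disputed] -/
theorem exists_infKappaCoricPair_ne_C [IsAlgClosed L] (hT : ∀ e ∈ T.pts, IsAlgebraic ℚ e) :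
    ∃ x : T.infKappaCoricPair.carrier,
      ∀ c : L, (x : RatAlgClosure L) ≠ algebraMap (RatFunc L) (RatAlgClosure L) (RatFunc.C c) := by
  obtain ⟨x, hx, hne⟩ := T.exists_mem_infKappaCoricSetIn_ne_C (RatAlgClosure L) hT
  exact ⟨⟨x, hx⟩, hne⟩

end CriticalLocus

end Literature.IUT.HodgeTheaters
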